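import Mathlib
import Summits.Ventures.PercRepro2.GradedClosure

/-! # The Hall reading of lower-set domination, generically — and for the graded families G_k, V2_k
(seat mine-b, cell pub-perc-repro2; MINE-B.md §18.1(a), §20.13, §21)

A **lower-set domination** statement `LowerDom S T b` on a finite preorder says: every lower set `D`
has `#(D ∩ T) ≥ Σ_{D ∩ S} b` (weight `[T] − b·[S]` non-negative on every lower set).  By Hall's marriage
theorem (Mathlib, `Finset.all_card_le_biUnion_card_iff_exists_injective`) on the sources replicated `b`
times, this is a **private assignment**: an injective map from the slots `(x ∈ S, i < b x)` to targets
`y ∈ T` with `y ≤ x` (`exists_private_targets_of_lowerDom`; DownDomHall.lean is the case `S = {r = 0}`,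
`T = {r = 1}`).  Instantiated to the graded families of GradedClosure.lean:

* `exists_private_targets_of_gDom`: from `GDom k r b`, every `x` with `r x = 0`, `b x ≥ k` owns `b x`
  private `y ≤ x` with `r y = 1` and `b y ≥ k − 1` — on a pattern cube, every configuration `γ` with
  `F_R = 0`, `F_B = a ≥ k` owns `a` private `γ′ ⊆ γ` with `F_R(γ′) = 1` AND `F_B(γ′) ≥ k − 1`: the
  level-conditioned form of MINE-B.md §18.1(a), one level at a time;
* `exists_private_targets_of_vDom`: from `VDom k r b`, targets with `b y = k − 1` and `r y ≥ 1`.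
-/

namespace Summit.Ventures.PercRepro2.UHClosure

open Finset

variable {X : Type*} [Preorder X] [Fintype X] [DecidableEq X] [DecidableRel (α := X) (· ≤ ·)]

/-- **lower-set domination**: every lower set `D` has `#(D ∩ T) ≥ Σ_{D ∩ S} b` -/
def LowerDom (S T : X → Prop) [DecidablePred S] [DecidablePred T] (b : X → ℕ) : Prop :=
  ∀ D : Finset X, IsLowerSet (↑D : Set X) →
    0 ≤ ∑ x ∈ D, ((if T x then (1 : ℤ) else 0) - (if S x then (b x : ℤ) else 0))

section generic

variable (S T : X → Prop) [DecidablePred S] [DecidablePred T] (b : X → ℕ)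

/-- the sources with positive demand -/
abbrev SrcL := {x : X // S x ∧ 1 ≤ b x}

/-- a bound on the demands, used to index the replicas -/
def boundL : ℕ := univ.sup b + 1

omit [Preorder X] [DecidableEq X] [DecidableRel (α := X) (· ≤ ·)] in
/-- every demand is below the bound -/
lemma lt_boundL (x : X) : b x < boundL b := Nat.lt_succ_of_le (Finset.le_sup (mem_univ x))

/-- the slots: a source `x` replicated `b x` times (`i < b x`) -/
abbrev SlotL := {p : SrcL S b × Fin (boundL b) // p.2.val < b p.1.1}

/-- the admissible targets of a slot: the elements of `T` below its source -/
def targetsL (p : SlotL S b) : Finset X := univ.filter (fun y => y ≤ p.1.1.1 ∧ T y)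

/-- the lower closure of the sources of a set of slots -/
def downClosureL (s : Finset (SlotL S b)) : Finset X := univ.filter (fun y => ∃ p ∈ s, y ≤ p.1.1.1)

omit [DecidableEq X] [DecidablePred S] in
/-- the lower closure is a lower set -/
lemma downClosureL_isLowerSet (s : Finset (SlotL S b)) : IsLowerSet (↑(downClosureL S b s) : Set X) := by
  intro y z hzy hy
  simp only [downClosureL, coe_filter, mem_univ, true_and, Set.mem_setOf_eq] at hy ⊢
  obtain ⟨p, hp, hle⟩ := hy
  exact ⟨p, hp, hzy.trans hle⟩

omit [DecidablePred S] in
/-- the union of the targets of a set of slots is `T ∩ (lower closure)` -/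
lemma biUnion_targetsL (s : Finset (SlotL S b)) :
    s.biUnion (targetsL S T b) = (downClosureL S b s).filter T := by
  ext y
  simp only [mem_biUnion, targetsL, downClosureL, mem_filter, mem_univ, true_and]
  constructor
  · rintro ⟨p, hp, hle, hy⟩
    exact ⟨⟨p, hp, hle⟩, hy⟩
  · rintro ⟨⟨p, hp, hle⟩, hy⟩
    exact ⟨p, hp, hle, hy⟩

omit [Preorder X] [DecidableRel (α := X) (· ≤ ·)] [DecidablePred S] in
/-- the slots of a set over a fixed source are at most `b` of them -/
lemma card_fibreL_le (s : Finset (SlotL S b)) (x : SrcL S b) :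
    (s.filter (fun p => p.1.1 = x)).card ≤ b x.1 := by
  have h : (s.filter (fun p => p.1.1 = x)).card ≤ (Finset.range (b x.1)).card := by
    apply Finset.card_le_card_of_injOn (fun p => p.1.2.val)
    · intro p hp
      simp only [Finset.mem_coe, mem_filter] at hp
      simp only [Finset.coe_range, Set.mem_Iio]
      rw [← hp.2]; exact p.2
    · intro p hp q hq hpq
      simp only [Finset.mem_coe, mem_filter] at hp hq
      apply Subtype.ext
      apply Prod.ext
      · rw [hp.2, hq.2]
      · exact Fin.ext hpq
  simpa using h

omit [Preorder X] [DecidableRel (α := X) (· ≤ ·)] [DecidablePred S] in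
/-- the number of slots of a set is at most the `b`-weighted number of its sources -/
lemma card_slotsL_le (s : Finset (SlotL S b)) :
    (s.card : ℤ) ≤ ∑ x ∈ s.image (fun p => p.1.1), (b x.1 : ℤ) := by
  rw [Finset.card_eq_sum_card_image (fun p => p.1.1) s]
  push_cast
  apply Finset.sum_le_sum
  intro x _
  exact_mod_cast card_fibreL_le S b s x

/-- the source weight `b·[S]` -/
def wSL (y : X) : ℤ := if S y then (b y : ℤ) else 0

omit [Preorder X] [Fintype X] [DecidableEq X] [DecidableRel (α := X) (· ≤ ·)] in
/-- the source weight is non-negative -/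
lemma wSL_nonneg (y : X) : 0 ≤ wSL S b y := by
  unfold wSL; split_ifs <;> simp

/-- the `b`-weighted sources of a set of slots are part of the source mass of the lower closure -/
lemma sum_sourcesL_le (s : Finset (SlotL S b)) :
    ∑ x ∈ s.image (fun p => p.1.1), (b x.1 : ℤ) ≤ ∑ y ∈ downClosureL S b s, wSL S b y := by
  have h1 : ∑ x ∈ s.image (fun p => p.1.1), (b x.1 : ℤ)
      = ∑ y ∈ (s.image (fun p => p.1.1)).map ⟨Subtype.val, Subtype.val_injective⟩, wSL S b y := by
    rw [Finset.sum_map]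
    apply Finset.sum_congr rfl
    intro x _
    simp only [Function.Embedding.coeFn_mk, wSL, x.2.1, if_true]
  rw [h1]
  apply Finset.sum_le_sum_of_subset_of_nonneg
  · intro y hy
    simp only [mem_map, mem_image, Function.Embedding.coeFn_mk] at hy
    obtain ⟨x, ⟨p, hp, hpx⟩, rfl⟩ := hy
    simp only [downClosureL, mem_filter, mem_univ, true_and]
    exact ⟨p, hp, by rw [hpx]⟩
  · intro y _ _; exact wSL_nonneg _ _ _

/-- **Hall's condition from lower-set domination**: any set of slots has at least as many admissible
targets as slots. -/
lemma hall_conditionL (h : LowerDom S T b) (s : Finset (SlotL S b)) :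
    s.card ≤ (s.biUnion (targetsL S T b)).card := by
  have hD := h (downClosureL S b s) (downClosureL_isLowerSet S b s)
  have hsplit : ∑ y ∈ downClosureL S b s, ((if T y then (1 : ℤ) else 0) - (if S y then (b y : ℤ) else 0))
      = ∑ y ∈ downClosureL S b s, (if T y then (1 : ℤ) else 0) - ∑ y ∈ downClosureL S b s, wSL S b y := by
    rw [← Finset.sum_sub_distrib]
    exact Finset.sum_congr rfl (fun y _ => rfl)
  have hT : ∑ y ∈ downClosureL S b s, (if T y then (1 : ℤ) else 0) = ((s.biUnion (targetsL S T b)).card : ℤ) := by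
    rw [biUnion_targetsL, Finset.card_filter]
    push_cast
    rfl
  have h1 := card_slotsL_le S b s
  have h2 := sum_sourcesL_le S b s
  have : (s.card : ℤ) ≤ ((s.biUnion (targetsL S T b)).card : ℤ) := by linarith
  exact_mod_cast this

/-- **The private assignment of a lower-set domination**: every source `x` owns `b x` private targets
below it — an injective map on the slots. -/
theorem exists_private_targets_of_lowerDom (h : LowerDom S T b) :
    ∃ f : SlotL S b → X, Function.Injective f ∧ ∀ p : SlotL S b, f p ≤ p.1.1.1 ∧ T (f p) := by
  obtain ⟨f, hf, hmem⟩ := (Finset.all_card_le_biUnion_card_iff_exists_injective (targetsL S T b)).1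
    (hall_conditionL S T b h)
  refine ⟨f, hf, fun p => ?_⟩
  have := hmem p
  simp only [targetsL, mem_filter, mem_univ, true_and] at this
  exact this

end generic

section graded

variable (k : ℕ) (r b : X → ℕ)

omit [Fintype X] [DecidableEq X] [DecidableRel (α := X) (· ≤ ·)] in
/-- `G_k` is the lower-set domination with sources `{r = 0, b ≥ k}` and targets `{r = 1, b ≥ k−1}` -/
theorem lowerDom_of_gDom (h : GDom k r b) :
    LowerDom (fun x => r x = 0 ∧ k ≤ b x) (fun x => r x = 1 ∧ k - 1 ≤ b x) b := by
  intro D hD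
  have := h D hD
  refine le_of_le_of_eq this (Finset.sum_congr rfl (fun x _ => ?_))
  unfold gw
  rfl

omit [Fintype X] [DecidableEq X] [DecidableRel (α := X) (· ≤ ·)] in
/-- `V2_k` is the lower-set domination with sources `{r = 0, b ≥ k}` and targets `{b = k−1, r ≥ 1}` -/
theorem lowerDom_of_vDom (h : VDom k r b) :
    LowerDom (fun x => r x = 0 ∧ k ≤ b x) (fun x => b x = k - 1 ∧ 1 ≤ r x) b := by
  intro D hD
  have := h D hD
  refine le_of_le_of_eq this (Finset.sum_congr rfl (fun x _ => ?_))
  unfold vw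
  rfl

/-- **the private assignment of `G_k`**: every `x` with `r x = 0`, `b x ≥ k` (and `b x ≥ 1`) owns `b x`
private `y ≤ x` with `r y = 1` and `b y ≥ k − 1` -/
theorem exists_private_targets_of_gDom (h : GDom k r b) :
    ∃ f : SlotL (fun x => r x = 0 ∧ k ≤ b x) b → X, Function.Injective f ∧
      ∀ p, f p ≤ p.1.1.1 ∧ r (f p) = 1 ∧ k - 1 ≤ b (f p) :=
  exists_private_targets_of_lowerDom _ _ b (lowerDom_of_gDom k r b h)

/-- **the private assignment of `V2_k`**: every `x` with `r x = 0`, `b x ≥ k` (and `b x ≥ 1`) owns `b x`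
private `y ≤ x` with `b y = k − 1` and `r y ≥ 1` -/
theorem exists_private_targets_of_vDom (h : VDom k r b) :
    ∃ f : SlotL (fun x => r x = 0 ∧ k ≤ b x) b → X, Function.Injective f ∧
      ∀ p, f p ≤ p.1.1.1 ∧ b (f p) = k - 1 ∧ 1 ≤ r (f p) :=
  exists_private_targets_of_lowerDom _ _ b (lowerDom_of_vDom k r b h)

end graded

end Summit.Ventures.PercRepro2.UHClosure
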